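import Summits.AtomisticToContinuum.Crystallization.Theorems.FrustratedLawDichotomyStrainedPatchRobustRows

/-!
(SPLIT FOR THE 400-LINE CAP by the landing lane, hand-2 g31: this file = part 1 of 2; sequels `…FrustratedLawDichotomyStrainedPatchStretchRows` import it in a chain; same namespace, all FQNs unchanged.)
# Strained patch — STRETCH-AWARE SOUND ROWS, the INTERIOR CHAIN with its three explicit ingredients, and the KINK VOID
# (cell `decomp-a2c`, lens 5 «finite/base range + asymptotic regime + bridge», generation 67; one level below 66R «RobustRows»)

66R split the tube floor of record `(TF) TubeFloor FamP (1/80)` as `(LOC∇ m) RelTexture ∧ (FT∇ m) RobustTubeCert` and left (LOC∇ m) for `m < 2τ`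
IDEA-NEEDED.  This node does three things.

§1  **(LOC∇) WITH ITS THREE «EOS» INGREDIENTS AS EXPLICIT HYPOTHESES** (critic row 1129 (f)).  Inner-ball versions `RelTextureIn 𝓘 τ r m` /
    `RobustTubeCertIn 𝓘 τ r m` (texture asked only on bonds with both ends in `ball r`, `r ≤ 63/10`; `r = 63/10` is 66R verbatim), and the chain
    (LOC∇ᵢₙ r k_n) ⟸ (E1) `InteriorRows` [sound linearised rows with a texture-dependent slack table — linearised lattice elasticity; PROVED from
    (FC σ)✓ + 66R's (ROW∇ K X)] ∧ (E2) `LinInteriorCert … (k i) (k (i+1))` for `i < n` [the discrete interior estimate = the lattice Green's-function decay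
    made FINITE: one second-order-cone programme per host instance, NO admissibility hypothesis, phrased like 57Q's `NeedCert`] ∧ (E3) induction from the
    a-priori texture `k 0 = 2τ` [PROVED: `relTextureIn_of_chain`, exactly 57Q's `slavingEnclosure_of_chain`].  Non-vacuity: every piece holds at `2τ`
    (`relTextureIn_two_tau`, `linInteriorCert_of_le`), so the junction is 66R's record at `n = 0` and has content iff some step has `k (i+1) < k i`.

§2  ★ **THE KINK VOID — the lens's number «how far must the finite range reach for the perturbative bridge to bite»: NO finite `τ`.**  On the perfect
    fcc host the one-plane `(110)` shear kink of amplitude `τ` (texture exactly `2τ` across the plane, polarisation `(1,−1,0)`) generates linearised forces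
    `≤ s⋆·τ` with `s⋆ = 6` in the nearest-neighbour model (exact: `Σ 6(x̂·v)x̂` over the four half-plane bonds) and `s⋆ = 5.162` with all shells `≤ 4`
    (memo §2, `work/kink_void.py`, pure python 3 s).  The a-priori row slack of ANY structure-free second-order bound is `σ₁ + K(τ)·(2τ)²` with
    `K(τ) = ½Σ_b sup_tube‖D²f_b‖ ≥ 779` for every `τ ≤ 1/40` (`1186` at `1/80`; 66R's `K ≈ 1200`), and `σ₁ + 4Kτ² > s⋆τ` for EVERY `τ > 0` as soon as
    `16·K·σ₁ > s⋆²`, i.e. `K ≥ 155` (`kink_in_polytope_all_tau` records it with the rational surrogate `s = 26/5 ≥ s⋆`, `K ≥ 160`; AM–GM in the kernel;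
    `sigmaOne = 8892/7⁷`).  Hence the texture-`2τ` kink lies in the
    linearised row polytope at the a-priori slack for every `τ`: (E2) fed with (E1)-from-(ROW∇) returns `k 1 = k 0 = 2τ` — the chain §1 CANNOT START at any
    tolerance, by a factor `≥ 779/155 ≈ 5` in `K` (`≈ 2.2` in force).  (LOC∇ m < 2τ) is therefore NOT reachable by force cap + Taylor/secant linearisation with
    box-worst-case slack (the class of 57Q/58C/66R §3 and of the Cauchy–Born residual estimates of E–Ortner–Shapeev): it is NON-PERTURBATIVE.  Physically the
    kink is excluded by (FC) by a factor `≈ 6` at `τ = 1/80` (true force `5.16τ = 0.065 ≫ σ₁ = 0.0108`; force-capped kinks have texture `≤ 2σ₁/5.16 ≈ 1/240`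
    at every `τ`): the void is an artefact of WORST-CASE slack, whose mass (`≈ 89 %` of `K`) is the RADIAL pair curvature `½ sup_tube|φ''r| ≈ 99–108` per unit
    bond (`τ = 1/100 … 1/80`), excited only by bond STRETCHES.

§3  ★★ **STRETCH-AWARE SOUND ROWS (SR) — the way round for the certificate.**  Split the force-linearisation remainder at a reach site into the radial part,
    a weighted quadratic form in the bond-length changes `s_b = |z a − z b| − |z₀(e a) − z₀(e b)|` (`sqStretch kr a = Σ_b kr(r⁰_b)·s_b²`) — which the
    certificate's exact secant ENERGY floors already see — and the angular part `K_ang·m²` with `K_ang ≈ 63–131` at `1/80` depending on the split (memo §3 / work/sr_tables.out: secant-in-r 63, V‴ 76, D²f 131; vs `K ≈ 1186`):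
    `‖F_a − ℓ_a‖ ≤ K_ang(e a)·m² + Σ_b kr(r⁰_b)·s_b² + X(e a)` (`StretchRowEnclosure`, ANALYTIC·ATTACKABLE (M); `kr` a fixed function of the reference bond length, `≈ 98–217` at `1`, nn-supported).  The matching certificate FORMAT
    `StretchTubeCert` prices rows at the A-PRIORI texture `2τ` — slack `σ₁ + X + K_ang(2τ)²`, i.e. `(1+κ)σ₁ + X` with `κ ≈ 3.6–7.6` at `1/80` (`2.3–4.3` at `1/100`, `1.7–2.9` at the
    empirical deg-3 cover tolerance `1/118` of COVER-60; secant-in-r split … D²f split) instead of 66R's `≈ 70σ₁` — and charges `Σ_b kr·s_b²` to the secant floors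
    (`score_dominates_stretch_rows` + `stretch_certificate`: the replay target of row 1129 (f) with the error functional made explicit: a CONSTANT
    `E₀ = Σ_a ν_a((1−θ)/θ)A_a²` plus a CHARGED quadratic stretch functional `Q = Σ_a c_a·sqStretch a` subtracted from the model).  JUNCTION PROVED:
    (FC σ₁)✓ ∧ (SR) ∧ (FT∇ˢʳ) ⟹ (TF) ⟹ [CORE-FAR] with 61H's cover — NO texture theorem (LOC∇) on this path: the IDEA-NEEDED leaf of 66R is BYPASSED iff
    the census's engine certifies with rows at `(1+κ)σ₁ + X`, `κ ≥ 3.6` (`1/80`) / `2.3` (`1/100`) / `1.7` (`1/118`) for the secant-in-r split (`7.6 / 4.3 / 2.9` for the plain D²f split), and stretch charges `c_a` inside the secant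
    curvature budget (ASK AUG-67sr).  Every piece is tagged in its docstring; `[formal bookkeeping]` marks plumbing.
-/

namespace Summit.AtomisticToContinuum.Crystallization.Theorems.FrustratedLawDichotomyStrainedPatchStretchRows

open scoped BigOperators Classical RealInnerProductSpace
open Summit.AtomisticToContinuum.Crystallization.Theorems.FrustratedLawDichotomyMotifLemmas
open Summit.AtomisticToContinuum.Crystallization.Theorems.FrustratedLawDichotomyAveragingCut
open Summit.AtomisticToContinuum.Crystallization.Theorems.FrustratedLawDichotomyStrainedPatchHomSplit
open Summit.AtomisticToContinuum.Crystallization.Theorems.FrustratedLawDichotomyStrainedPatchCleanCollar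
open Summit.AtomisticToContinuum.Crystallization.Theorems.FrustratedLawDichotomyStrainedPatchPhaseCut
open Summit.AtomisticToContinuum.Crystallization.Theorems.FrustratedLawDichotomyStrainedPatchCoreTube
open Summit.AtomisticToContinuum.Crystallization.Theorems.FrustratedLawDichotomyStrainedPatchAugmentedEnvelope
open Summit.AtomisticToContinuum.Crystallization.Theorems.FrustratedLawDichotomyStrainedPatchEnvelopeLaw
open Summit.AtomisticToContinuum.Crystallization.Theorems.FrustratedLawDichotomyStrainedPatchEnvelopeTaylor
open Summit.AtomisticToContinuum.Crystallization.Theorems.FrustratedLawDichotomyStrainedPatchChartFamilies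
open Summit.AtomisticToContinuum.Crystallization.Theorems.FrustratedLawDichotomyStrainedPatchQuantSlaving
open Summit.AtomisticToContinuum.Crystallization.Theorems.FrustratedLawDichotomyStrainedPatchHostCells
open Summit.AtomisticToContinuum.Crystallization.Theorems.FrustratedLawDichotomyStrainedPatchForceCap
open Summit.AtomisticToContinuum.Crystallization.Theorems.FrustratedLawDichotomyStrainedPatchRobustRows

/-! ## §1. Inner-ball texture, the three explicit ingredients (E1)(E2)(E3), and the chain -/

/-- The INNER TEXTURE predicate of one chart: relative texture `≤ m` on every bond (reach site `a`, move-test neighbour `b`) with BOTH ends in `ball r`. -/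
def TexIn {M : ℕ} (z : Fin M → E3) (c : Fin M) {M₀ : ℕ} (z₀ : Fin M₀ → E3) (c₀ : Fin M₀) (e : Fin M → Fin M₀) (r m : ℝ) : Prop :=
  ∀ a ∈ ball r z c, IsReach z c a → ∀ b ∈ moveNbrs 7 z a, b ∈ ball r z c → relTex z c z₀ c₀ e a b ≤ m

/-- The ROWS predicate of one chart for a texture-indexed slack table `S`: at every reach site `a` of the charted ball and every local texture bound `t ≥ 0`
at `a`, `‖ℓ_a‖ ≤ S t (e a)`. -/
def RowsIn (H : HessTab) (F : ForceTab) (S : ℝ → SlackTab) {M : ℕ} (z : Fin M → E3) (c : Fin M) {M₀ : ℕ} (z₀ : Fin M₀ → E3) (c₀ : Fin M₀)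
    (e : Fin M → Fin M₀) : Prop :=
  ∀ a ∈ ball (63 / 10) z c, IsReach z c a → ∀ t : ℝ, 0 ≤ t → (∀ b ∈ moveNbrs 7 z a, b ∈ ball (63 / 10) z c → relTex z c z₀ c₀ e a b ≤ t) →
    ‖linForce H F z c z₀ c₀ e a‖ ≤ S t M₀ z₀ c₀ (e a)

/-- ★ **(LOC∇ᵢₙ r m) `RelTextureIn 𝓘 τ r m`** [ASYMPTOTIC-REGIME THEOREM · PROVED at `m = 2τ` · for `m < 2τ` NON-PERTURBATIVE (§2) · STRICTLY WEAKER than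
66R's (LOC∇ m) for `r < 63/10` (`relTextureIn_of_relTexture`), EQUAL at `r = 63/10` (`relTexture_iff_in`)] — admissible clean mono-phase clusters `τ`-charted by
an instance of `𝓘` have relative texture `≤ m` on the bonds of `ball r`. -/
def RelTextureIn (𝓘 : ChartFam) (τ r m : ℝ) : Prop :=
  ∀ (M : ℕ) (z : Fin M → E3) (c : Fin M) (M₀ : ℕ) (z₀ : Fin M₀ → E3) (c₀ : Fin M₀) (e : Fin M → Fin M₀),
    Admissible M z c → CleanBall (63 / 10) z c → MonoPhaseBall (63 / 10) z c → ChartBy 𝓘 τ τ z c z₀ c₀ e → TexIn z c z₀ c₀ e r m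

/-- ★ **(FT∇ᵢₙ r m) `RobustTubeCertIn 𝓘 τ r m`** [FINITE RANGE · INSTRUMENTABLE (66R's sound format with rows priced at texture `m` on `ball r` only, at
`2τ` elsewhere — the census's «inner-ν» variant) · STRONGER than (FT∇ m) for `r < 63/10`] — the tube floor restricted to charts of inner texture `≤ m`. -/
def RobustTubeCertIn (𝓘 : ChartFam) (τ r m : ℝ) : Prop :=
  ∀ (M : ℕ) (z : Fin M → E3) (c : Fin M) (M₀ : ℕ) (z₀ : Fin M₀ → E3) (c₀ : Fin M₀) (e : Fin M → Fin M₀),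
    Admissible M z c → CleanBall (63 / 10) z c → MonoPhaseBall (63 / 10) z c → ChartBy 𝓘 τ τ z c z₀ c₀ e → TexIn z c z₀ c₀ e r m →
      0 ≤ ballAvg (9 / 5) z (xRec M z) c

/-- ★ **(E1) `InteriorRows 𝓘 τ H F S`** [ANALYTIC · = (FC σ)✓ + 66R's (ROW∇ K X), PROVED as `interiorRows_of_forceCap_of_rowEnclosure`; the «linearised lattice
elasticity» ingredient] — on every `τ`-chart of an admissible clean mono-phase cluster the linearised rows hold with the texture-indexed slack table `S`. -/
def InteriorRows (𝓘 : ChartFam) (τ : ℝ) (H : HessTab) (F : ForceTab) (S : ℝ → SlackTab) : Prop :=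
  ∀ (M : ℕ) (z : Fin M → E3) (c : Fin M) (M₀ : ℕ) (z₀ : Fin M₀ → E3) (c₀ : Fin M₀) (e : Fin M → Fin M₀),
    Admissible M z c → CleanBall (63 / 10) z c → MonoPhaseBall (63 / 10) z c → ChartBy 𝓘 τ τ z c z₀ c₀ e → RowsIn H F S z c z₀ c₀ e

/-- ★ **(E2) `LinInteriorCert 𝓘 τ r H F S m m'`** [INSTRUMENTABLE — one finite second-order-cone programme per instance, NO admissibility / cleanness / phase
hypothesis (cf. 57Q `NeedCert`); the «lattice Green's function + interior estimate» ingredient made finite: maximise a bond's relative texture over deviation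
fields in the `τ`-box with inner texture `≤ m` and rows `S`] — every such chart has inner texture `≤ m'`.  VOID (`m' = m` forced) whenever the slack exceeds
the kink force of §2. -/
def LinInteriorCert (𝓘 : ChartFam) (τ r : ℝ) (H : HessTab) (F : ForceTab) (S : ℝ → SlackTab) (m m' : ℝ) : Prop :=
  ∀ (M : ℕ) (z : Fin M → E3) (c : Fin M) (M₀ : ℕ) (z₀ : Fin M₀ → E3) (c₀ : Fin M₀) (e : Fin M → Fin M₀),
    ChartBy 𝓘 τ τ z c z₀ c₀ e → TexIn z c z₀ c₀ e r m → RowsIn H F S z c z₀ c₀ e → TexIn z c z₀ c₀ e r m'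

/-- `ball r ⊆ ball r'` for `r ≤ r'`. [formal bookkeeping] -/
theorem mem_ball_of_le {r r' : ℝ} (h : r ≤ r') {M : ℕ} {z : Fin M → E3} {c a : Fin M} (ha : a ∈ ball r z c) : a ∈ ball r' z c :=
  mem_ball.2 ((mem_ball.1 ha).trans h)

/-- 66R's (LOC∇ m) IS (LOC∇ᵢₙ 63/10 m). [formal bookkeeping] -/
theorem relTexture_iff_in (𝓘 : ChartFam) (τ m : ℝ) : RelTexture 𝓘 τ m ↔ RelTextureIn 𝓘 τ (63 / 10) m := Iff.rfl

/-- 66R's (FT∇ m) IS (FT∇ᵢₙ 63/10 m). [formal bookkeeping] -/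
theorem robustTubeCert_iff_in (𝓘 : ChartFam) (τ m : ℝ) : RobustTubeCert 𝓘 τ m ↔ RobustTubeCertIn 𝓘 τ (63 / 10) m := Iff.rfl

/-- Inner texture is MONOTONE in `m` and ANTITONE in `r`. [formal bookkeeping] -/
theorem TexIn.mono {M : ℕ} {z : Fin M → E3} {c : Fin M} {M₀ : ℕ} {z₀ : Fin M₀ → E3} {c₀ : Fin M₀} {e : Fin M → Fin M₀} {r r' m m' : ℝ}
    (h : TexIn z c z₀ c₀ e r' m) (hr : r ≤ r') (hm : m ≤ m') : TexIn z c z₀ c₀ e r m' :=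
  fun a ha hr' b hb hb' => (h a (mem_ball_of_le hr ha) hr' b hb (mem_ball_of_le hr hb')).trans hm

/-- (LOC∇ m) ⟹ (LOC∇ᵢₙ r m') for `r ≤ 63/10`, `m ≤ m'`. [formal bookkeeping] -/
theorem relTextureIn_of_relTexture {𝓘 : ChartFam} {τ r m m' : ℝ} (h : RelTexture 𝓘 τ m) (hr : r ≤ 63 / 10) (hm : m ≤ m') : RelTextureIn 𝓘 τ r m' :=
  fun M z c M₀ z₀ c₀ e hz hcl hmo hch => TexIn.mono (r' := 63 / 10) (h M z c M₀ z₀ c₀ e hz hcl hmo hch) hr hm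

/-- (LOC∇ᵢₙ) is monotone in `m`, antitone in `r`. [formal bookkeeping] -/
theorem RelTextureIn.mono {𝓘 : ChartFam} {τ r r' m m' : ℝ} (h : RelTextureIn 𝓘 τ r' m) (hr : r ≤ r') (hm : m ≤ m') : RelTextureIn 𝓘 τ r m' :=
  fun M z c M₀ z₀ c₀ e hz hcl hmo hch => (h M z c M₀ z₀ c₀ e hz hcl hmo hch).mono hr hm

/-- (FT∇ᵢₙ) is antitone in `m`, monotone in `r` (a certificate needing texture control on a SMALLER ball is a stronger certificate). [formal bookkeeping] -/
theorem RobustTubeCertIn.anti {𝓘 : ChartFam} {τ r r' m m' : ℝ} (h : RobustTubeCertIn 𝓘 τ r m') (hr : r ≤ r') (hm : m ≤ m') : RobustTubeCertIn 𝓘 τ r' m :=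
  fun M z c M₀ z₀ c₀ e hz hcl hmo hch ht => h M z c M₀ z₀ c₀ e hz hcl hmo hch (ht.mono hr hm)

/-- ★ **THE INNER BRIDGE** — (LOC∇ᵢₙ r m) ∧ (FT∇ᵢₙ r m) ⟹ (TF). [formal bookkeeping] -/
theorem tubeFloor_of_relTextureIn_of_certIn {𝓘 : ChartFam} {τ r m : ℝ} (hL : RelTextureIn 𝓘 τ r m) (hC : RobustTubeCertIn 𝓘 τ r m) : TubeFloor 𝓘 τ :=
  fun M z c M₀ z₀ c₀ e hz hcl hmo hch => hC M z c M₀ z₀ c₀ e hz hcl hmo hch (hL M z c M₀ z₀ c₀ e hz hcl hmo hch)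

/-- Conversely (TF) is (FT∇ᵢₙ r m) for every `r`, `m`. [formal bookkeeping] -/
theorem robustTubeCertIn_of_tubeFloor {𝓘 : ChartFam} {τ : ℝ} (h : TubeFloor 𝓘 τ) (r m : ℝ) : RobustTubeCertIn 𝓘 τ r m :=
  fun M z c M₀ z₀ c₀ e hz hcl hmo hch _ => h M z c M₀ z₀ c₀ e hz hcl hmo hch

/-- The a-priori inner texture of one chart: `2τ` (both ends in the charted ball). [formal bookkeeping] -/
theorem texIn_two_tau {𝓘 : ChartFam} {τ t r : ℝ} (hr : r ≤ 63 / 10) {M : ℕ} {z : Fin M → E3} {c : Fin M} {M₀ : ℕ} {z₀ : Fin M₀ → E3} {c₀ : Fin M₀}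
    {e : Fin M → Fin M₀} (hch : ChartBy 𝓘 τ t z c z₀ c₀ e) : TexIn z c z₀ c₀ e r (2 * τ) := by
  intro a ha _ b _ hb
  have ha' := norm_dev_le_of_chartBy hch (mem_ball_of_le hr ha)
  have hb' := norm_dev_le_of_chartBy hch (mem_ball_of_le hr hb)
  calc relTex z c z₀ c₀ e a b = ‖dev z c z₀ c₀ e b - dev z c z₀ c₀ e a‖ := rfl
    _ ≤ ‖dev z c z₀ c₀ e b‖ + ‖dev z c z₀ c₀ e a‖ := norm_sub_le _ _
    _ ≤ 2 * τ := by linarith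

/-- ★ (LOC∇ᵢₙ r 2τ) PROVED for `r ≤ 63/10`. -/
theorem relTextureIn_two_tau (𝓘 : ChartFam) (τ : ℝ) {r : ℝ} (hr : r ≤ 63 / 10) : RelTextureIn 𝓘 τ r (2 * τ) :=
  fun _ _ _ _ _ _ _ _ _ _ hch => texIn_two_tau hr hch

/-- At `m = 2τ` the inner split is not a split either: (FT∇ᵢₙ r 2τ) ⟺ (TF). [formal bookkeeping] -/
theorem robustTubeCertIn_two_tau_iff (𝓘 : ChartFam) (τ : ℝ) {r : ℝ} (hr : r ≤ 63 / 10) : RobustTubeCertIn 𝓘 τ r (2 * τ) ↔ TubeFloor 𝓘 τ :=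
  ⟨fun h => tubeFloor_of_relTextureIn_of_certIn (relTextureIn_two_tau 𝓘 τ hr) h, fun h => robustTubeCertIn_of_tubeFloor h _ _⟩

/-- (E2) is NON-VACUOUS and trivially inhabited at the top: any `m' ≥ max m (2τ)`… in particular `m ≤ m'` gives a certificate (V1/V2 of row 1129 (f):
the hypothesis set of the chain is consistent; content = a step with `m' < m`). [formal bookkeeping] -/
theorem linInteriorCert_of_le {𝓘 : ChartFam} {τ r : ℝ} {H : HessTab} {F : ForceTab} {S : ℝ → SlackTab} {m m' : ℝ} (h : m ≤ m') :
    LinInteriorCert 𝓘 τ r H F S m m' :=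
  fun _ _ _ _ _ _ _ _ ht _ => ht.mono le_rfl h

/-- (E2) at the a-priori level from the chart box alone: `LinInteriorCert … m (2τ)` for `r ≤ 63/10`. [formal bookkeeping] -/
theorem linInteriorCert_two_tau {𝓘 : ChartFam} {τ r : ℝ} (hr : r ≤ 63 / 10) {H : HessTab} {F : ForceTab} {S : ℝ → SlackTab} (m : ℝ) :
    LinInteriorCert 𝓘 τ r H F S m (2 * τ) :=
  fun _ _ _ _ _ _ _ hch _ _ => texIn_two_tau hr hch

/-- ★ **(E1) PROVED from (FC σ) and 66R's (ROW∇ K X)**: slack table `S t = σ + K·t² + X`. [formal bookkeeping over `norm_lin_le_of_cap_of_rem`] -/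
theorem interiorRows_of_forceCap_of_rowEnclosure {𝓘 : ChartFam} {τ σ : ℝ} {K : SlackTab} {H : HessTab} {F : ForceTab} {X : SlackTab}
    (hF : ForceCapLaw σ) (hR : ForceRowEnclosure 𝓘 τ K H F X) :
    InteriorRows 𝓘 τ H F (fun t M₀ z₀ c₀ b => σ + K M₀ z₀ c₀ b * t ^ 2 + X M₀ z₀ c₀ b) := by
  intro M z c M₀ z₀ c₀ e hz hcl hmo hch a ha hr t ht htex
  exact norm_lin_le_of_cap_of_rem (hF M z c hz a hr) (hR M z c M₀ z₀ c₀ e t hz hcl hmo hch ht a ha hr htex)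

/-- ★ **ONE STEP (E3)**: (E1) ∧ (E2 at `m ↦ m'`) ∧ (LOC∇ᵢₙ r m) ⟹ (LOC∇ᵢₙ r m'). [formal bookkeeping] -/
theorem relTextureIn_step {𝓘 : ChartFam} {τ r : ℝ} {H : HessTab} {F : ForceTab} {S : ℝ → SlackTab} {m m' : ℝ} (hR : InteriorRows 𝓘 τ H F S)
    (hC : LinInteriorCert 𝓘 τ r H F S m m') (hL : RelTextureIn 𝓘 τ r m) : RelTextureIn 𝓘 τ r m' :=
  fun M z c M₀ z₀ c₀ e hz hcl hmo hch => hC M z c M₀ z₀ c₀ e hch (hL M z c M₀ z₀ c₀ e hz hcl hmo hch) (hR M z c M₀ z₀ c₀ e hz hcl hmo hch)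

/-- ★★ **THE CHAIN (E3) PROVED** — from (LOC∇ᵢₙ r (k 0)), the rows (E1) and certificates (E2) `k i ↦ k (i+1)` for `i < n`: (LOC∇ᵢₙ r (k n)).
(Induction verbatim as 57Q `slavingEnclosure_of_chain`.) -/
theorem relTextureIn_of_chain {𝓘 : ChartFam} {τ r : ℝ} {H : HessTab} {F : ForceTab} {S : ℝ → SlackTab} (k : ℕ → ℝ) (n : ℕ)
    (h0 : RelTextureIn 𝓘 τ r (k 0)) (hR : InteriorRows 𝓘 τ H F S) (hs : ∀ i : ℕ, i < n → LinInteriorCert 𝓘 τ r H F S (k i) (k (i + 1))) :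
    RelTextureIn 𝓘 τ r (k n) := by
  induction n with
  | zero => exact h0
  | succ n ih => exact relTextureIn_step hR (hs n n.lt_succ_self) (ih fun i hi => hs i (Nat.lt_succ_of_lt hi))

/-- The chain started at the a-priori texture `k 0 = 2τ`. [formal bookkeeping] -/
theorem relTextureIn_of_chain_apriori {𝓘 : ChartFam} {τ r : ℝ} (hr : r ≤ 63 / 10) {H : HessTab} {F : ForceTab} {S : ℝ → SlackTab} (k : ℕ → ℝ)
    (n : ℕ) (h0 : k 0 = 2 * τ) (hR : InteriorRows 𝓘 τ H F S) (hs : ∀ i : ℕ, i < n → LinInteriorCert 𝓘 τ r H F S (k i) (k (i + 1))) :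
    RelTextureIn 𝓘 τ r (k n) :=
  relTextureIn_of_chain k n (h0 ▸ relTextureIn_two_tau 𝓘 τ hr) hR hs

/-! ## §2. The kink void: the a-priori slack exceeds the kink force at EVERY tolerance -/

/-- The nearest-neighbour kink force per unit amplitude: the one-plane `(110)` shear kink (planes normal to `b̂ = (1,1,0)/√2`, spacing `1/2`, profile
`−1, 0, +1` over three consecutive planes, texture `2τ` on the bonds `±b̂`) with polarisation `v = (1,−1,0)/√2` loads a kink-plane site by
`Σ_b d_b·V''(1)(x̂_b·v)x̂_b` (`d_b ∈ {0, 1, 2}` the profile jumps; `V'(1) = 0` kills the transverse stiffness), of norm EXACTLY `ljD2 1 = 6` (memo §2,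
`work/kink_nn.py`; polarisation `ẑ` gives `12`, longitudinal `18`; with all shells `≤ 4.05` the three values are `5.162 / 11.82 / 16.69`). -/
noncomputable def kinkForceNN : ℝ := ljD2 1

/-- `kinkForceNN = 6`. [formal bookkeeping] -/
theorem kinkForceNN_eq : kinkForceNN = 6 := ljD2_one

/-- ★ **THE VOID INEQUALITY (AM–GM).**  If `16·K·σ > s²` then `σ + 4Kτ² > s·τ` for EVERY `τ`: a texture-`2τ` pattern of linear force `≤ sτ` lies in the
row polytope with a-priori slack `σ + K(2τ)²` at every tolerance — a certificate (E2) fed with such rows cannot lower the texture below `2τ`. [folklore] -/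
theorem slack_gt_kink_all_tau {K σ s : ℝ} (hK : 0 ≤ K) (h : s ^ 2 < 16 * K * σ) (τ : ℝ) : s * τ < σ + 4 * K * τ ^ 2 := by
  rcases hK.eq_or_lt with hK0 | hK0
  · rw [← hK0] at h
    nlinarith [sq_nonneg s]
  · have key : 16 * K * (σ + 4 * K * τ ^ 2 - s * τ) = (16 * K * σ - s ^ 2) + (8 * K * τ - s) ^ 2 := by ring
    have hpos : 0 < 16 * K * (σ + 4 * K * τ ^ 2 - s * τ) := by
      rw [key]
      nlinarith [sq_nonneg (8 * K * τ - s)]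
    have h16 : (0 : ℝ) < 16 * K := by positivity
    have := (mul_pos_iff_of_pos_left h16).1 hpos
    linarith

/-- ★ **RECORD (nearest-neighbour kink, `s = 6`)**: every structure-free constant `K ≥ 210` is void at every `τ` (`16·210·σ₁ = 36.28 > 36`); the actual
constants are `K(τ) ≥ 779` for all `τ ≤ 1/40` (memo §2 table; `1186` at `1/80`, 66R's `≈ 1200`). -/
theorem kink_in_polytope_all_tau_nn {K : ℝ} (hK : 210 ≤ K) (τ : ℝ) : kinkForceNN * τ < sigmaOne + 4 * K * τ ^ 2 := by
  rw [kinkForceNN_eq]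
  have h0 : (6 : ℝ) * τ < sigmaOne + 4 * 210 * τ ^ 2 := slack_gt_kink_all_tau (by norm_num) (by rw [sigmaOne]; norm_num) τ
  nlinarith [sq_nonneg τ]

/-- ★ **RECORD (all-shell kink, `s = 26/5 > 5.162`)**: every `K ≥ 160` is void at every `τ` (`16·160·σ₁ = 27.64 > 27.04`).  Margin at the constants of
record: `K(τ)/160 ≥ 4.9`. -/
theorem kink_in_polytope_all_tau {K : ℝ} (hK : 160 ≤ K) (τ : ℝ) : 26 / 5 * τ < sigmaOne + 4 * K * τ ^ 2 := by
  have h0 : (26 / 5 : ℝ) * τ < sigmaOne + 4 * 160 * τ ^ 2 := slack_gt_kink_all_tau (by norm_num) (by rw [sigmaOne]; norm_num) τ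
  nlinarith [sq_nonneg τ]

/-- The line-of-record instance: at `τ = 1/80` the a-priori slack `σ₁ + 1186·(1/40)² ≈ 0.752` exceeds the kink load `5.2/80 = 0.065` ELEVEN-fold, and even the
angular-only slack of the plain D²f split `σ₁ + 129·(1/40)² ≈ 0.091` exceeds it (`×1.4`; the secant-in-r split's `σ₁ + 63·(1/40)² ≈ 0.050` does NOT — memo §2:
after the stretch split the angular slack alone no longer contains the kink for `τ ∈ (1/60, 1/450)`, which is what makes the stretch path worth running). [formal bookkeeping] -/
theorem kink_void_at_record : (26 / 5 : ℝ) * (1 / 80) < sigmaOne + 129 * (2 * (1 / 80)) ^ 2 ∧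
    11 * ((26 / 5 : ℝ) * (1 / 80)) < sigmaOne + 1186 * (2 * (1 / 80)) ^ 2 := by
  rw [sigmaOne]; constructor <;> norm_num

end Summit.AtomisticToContinuum.Crystallization.Theorems.FrustratedLawDichotomyStrainedPatchStretchRows
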